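import Literature.Computability.Complexity.CodeFPFinite
import Summits.PneNP.PneNP.Theorems.SfmBlMachineWalks

/-!
# Line «sfm-bl», MACHINE LAYER M2b: the spot-extraction fold in the `CodeFP` algebra (stmt-PneNP-20523)

FRONTIER F-N1c; nothing here bears on P vs NP.

MACHINE-PLAN stage M2, second half: the extraction loop of PROOF-SFM-BL §5 (1) as a computable fold.
CANDIDATE PAIRS: the sides `(W₁, W₂)` (left / right piece labels, deduplicated) of the supports of the
enumerated walks of M2a (`SfmBlMachine.walksC`), kept when `|W₁| + |W₂| ≤ t₀` (`cands`).  STATE: one label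
per leg (`0` = remainder, `s + 1` = spot `s`) and the number `r` of spots created so far.  ROUND
(`extractStep`): the first candidate pair that is DENSE for the current remainder — integer test
`γsq · |W₁| · |W₂| < e²`, `e = #{remainder legs from W₁ to W₂}` (`eCount`; `γsq` = γ_sp² is an integer
by the choice of constants in `SfmBlNumerics`) — has those legs relabelled `r + 1` (`relabel`); if none
is dense the state is fixed.  `extract` runs `|u|` rounds from «all remainder».  Everything is parametric in
`(γsq, t₀, cap, ℓ)`; the §6 glue supplies them from `N`.

Typing: `codeFP_cands`, `codeFP_eCount`, `codeFP_relabel`, `codeFP_extractStep`, `codeFP_extract`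
(`CodeFP.foldl`, accumulator = `3m` labels `≤ r ≤ #rounds`, bound discharged by `ExtractInv`).  The five
clauses of `SfmBl.exists_spot_decomposition` for the computed output are M2c (math side; the facts
recorded here for it: `length_relabel`, `relabel_of_ne_zero`, `extractInv_foldl`).
-/

set_option linter.dupNamespace false -- `Summit.PneNP.PneNP.…`: summit = sub-problem name (D-0017 single-conjunct layout)

namespace Summit.PneNP.PneNP.Theorems.SfmBlMachine

open Literature.Computability.Complexity CodeFP

/-! ## The spec (plain list functions) -/

/-- A candidate pair: (left labels, right labels). -/
abbrev Cand := List Lab × List Lab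

/-- The two sides of a vertex list (deduplicated). -/
def sidesOf (vis : List Lab) : Cand :=
  ((vis.filter fun P => P.1 = 0).dedup, (vis.filter fun P => P.1 = 1).dedup)

/-- The candidate pairs: sides of the supports of the enumerated walks, of total size `≤ t₀`. -/
def cands (plegs : List PLeg) (cap t₀ : ℕ) (u : List Unit) : List Cand :=
  ((walksC plegs cap u).map fun w => sidesOf w.2).filter fun W => W.1.length + W.2.length ≤ t₀

/-- Test: a labelled leg lies in the remainder and runs from `W₁` to `W₂`. -/
def inPair (W : Cand) (q : ℕ × PLeg) : Bool :=
  decide (q.1 = 0) && (decide (labL q.2 ∈ W.1) && decide (labR q.2 ∈ W.2))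

/-- `e_R(W₁, W₂)`: the number of remainder legs from `W₁` to `W₂`. -/
def eCount (plegs : List PLeg) (labels : List ℕ) (W : Cand) : ℕ :=
  ((labels.zip plegs).filter fun q => inPair W q).length

/-- The integer density test `γsq·|W₁|·|W₂| < e²`. -/
def dense (γsq : ℕ) (plegs : List PLeg) (labels : List ℕ) (W : Cand) : Bool :=
  decide (γsq * W.1.length * W.2.length < eCount plegs labels W * eCount plegs labels W)

/-- Relabel the remainder legs from `W₁` to `W₂` as the new spot `r` (label `r + 1`). -/
def relabel (plegs : List PLeg) (labels : List ℕ) (r : ℕ) (W : Cand) : List ℕ :=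
  List.zipWith (fun lab x => if inPair W (lab, x) then r + 1 else lab) labels plegs

/-- One extraction round. -/
def extractStep (γsq : ℕ) (plegs : List PLeg) (cs : List Cand) (st : List ℕ × ℕ) : List ℕ × ℕ :=
  match cs.find? fun W => dense γsq plegs st.1 W with
  | none => st
  | some W => (relabel plegs st.1 st.2 W, st.2 + 1)

/-- The initial state: every leg in the remainder, no spots. -/
def extractInit (plegs : List PLeg) : List ℕ × ℕ := (plegs.map fun _ => 0, 0)

/-- The extraction: `|u|` rounds. -/
def extract (γsq : ℕ) (plegs : List PLeg) (cs : List Cand) (u : List Unit) : List ℕ × ℕ :=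
  u.foldl (fun st _ => extractStep γsq plegs cs st) (extractInit plegs)

/-! ## Bookkeeping facts for M2c -/

/-- Relabelling keeps one label per leg. -/
theorem length_relabel (plegs : List PLeg) (labels : List ℕ) (r : ℕ) (W : Cand) (h : labels.length = plegs.length) :
    (relabel plegs labels r W).length = plegs.length := by
  unfold relabel
  rw [List.length_zipWith, h, min_self]

/-- Relabelling never touches a leg that already belongs to a spot. -/
theorem getElem_relabel (plegs : List PLeg) (labels : List ℕ) (r : ℕ) (W : Cand) (i : ℕ)
    (hi : i < (relabel plegs labels r W).length) (h₁ : i < labels.length) (h₂ : i < plegs.length) :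
    (relabel plegs labels r W)[i] = if inPair W (labels[i], plegs[i]) then r + 1 else labels[i] := by
  unfold relabel
  rw [List.getElem_zipWith]

/-- A label after relabelling is the new label `r + 1` or an old label. -/
theorem mem_relabel {plegs : List PLeg} {labels : List ℕ} {r : ℕ} {W : Cand} {lab : ℕ}
    (h : lab ∈ relabel plegs labels r W) : lab = r + 1 ∨ lab ∈ labels := by
  unfold relabel at h
  rw [List.mem_iff_getElem] at h
  obtain ⟨i, hi, rfl⟩ := h
  rw [List.getElem_zipWith]
  rw [List.length_zipWith] at hi
  split_ifs
  · exact Or.inl rfl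
  · exact Or.inr (List.getElem_mem _)

/-- Invariant of the extraction fold after `k` rounds: one label per leg, labels `≤ r ≤ k`. -/
def ExtractInv (plegs : List PLeg) (k : ℕ) (st : List ℕ × ℕ) : Prop :=
  st.1.length = plegs.length ∧ (∀ lab ∈ st.1, lab ≤ st.2) ∧ st.2 ≤ k

/-- The initial state satisfies the invariant. -/
theorem extractInv_init (plegs : List PLeg) : ExtractInv plegs 0 (extractInit plegs) := by
  refine ⟨by simp [extractInit], fun lab hlab => ?_, le_rfl⟩
  simp only [extractInit, List.mem_map] at hlab
  obtain ⟨_, _, rfl⟩ := hlab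
  exact le_rfl

/-- One round preserves the invariant. -/
theorem extractInv_step (γsq : ℕ) (plegs : List PLeg) (cs : List Cand) {k : ℕ} {st : List ℕ × ℕ}
    (h : ExtractInv plegs k st) : ExtractInv plegs (k + 1) (extractStep γsq plegs cs st) := by
  obtain ⟨hlen, hlab, hr⟩ := h
  unfold extractStep
  cases hf : cs.find? (fun W => dense γsq plegs st.1 W) with
  | none => exact ⟨hlen, hlab, Nat.le_succ_of_le hr⟩
  | some W =>
    refine ⟨length_relabel plegs st.1 st.2 W hlen, fun lab hmem => ?_, Nat.succ_le_succ hr⟩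
    rcases mem_relabel hmem with rfl | hold
    · exact le_rfl
    · exact (hlab lab hold).trans (Nat.le_succ _)

/-- The invariant along the fold. -/
theorem extractInv_foldl (γsq : ℕ) (plegs : List PLeg) (cs : List Cand) :
    ∀ (u : List Unit) (k : ℕ) (st : List ℕ × ℕ), ExtractInv plegs k st →
      ExtractInv plegs (k + u.length) (u.foldl (fun st _ => extractStep γsq plegs cs st) st) := by
  intro u
  induction u with
  | nil => intro k st h; simpa using h
  | cons _ u ih =>
    intro k st h
    rw [List.foldl_cons, List.length_cons, show k + (u.length + 1) = (k + 1) + u.length by omega]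
    exact ih (k + 1) _ (extractInv_step γsq plegs cs h)

/-- The extraction output: one label per leg, labels `≤ r ≤ #rounds`. -/
theorem extractInv_extract (γsq : ℕ) (plegs : List PLeg) (cs : List Cand) (u : List Unit) :
    ExtractInv plegs u.length (extract γsq plegs cs u) := by
  have h := extractInv_foldl γsq plegs cs u 0 (extractInit plegs) (extractInv_init plegs)
  rwa [Nat.zero_add] at h

/-! ## Typing in the `CodeFP` algebra -/

section PolyTime

open Polynomial

/-- Code of a candidate pair. -/
abbrev candE : Cand → List Bool := pairE (rawE labE) (rawE labE)

/-- Code of an extraction state (labels, number of spots). -/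
abbrev xstE : List ℕ × ℕ → List Bool := pairE (rawE natE) natE

/-- `sidesOf` is polynomial time. -/
theorem codeFP_sidesOf : CodeFP (rawE labE) candE sidesOf := by
  have hside : ∀ c : ℕ, CodeFP (pairE unitE labE) bitE (fun t => decide (t.2.1 = c)) := fun c =>
    (natEq.comp ((snd _ _).fst'.pair (const _ c))).congr fun _ => rfl
  have hf : ∀ c : ℕ, CodeFP (rawE labE) (rawE labE) (fun vis => (vis.filter fun P => decide (P.1 = c)).dedup) :=
    fun c => ((dedup labE labE_injective).comp ((filter (hside c)).comp
      ((const (rawE labE) ()).pair (CodeFP.id (rawE labE))))).congr fun _ => rfl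
  exact ((hf 0).pair (hf 1)).congr fun _ => rfl

/-- `cands` is polynomial time (input `(((pieced legs, cap), rounds), t₀)`). -/
theorem codeFP_cands : CodeFP (pairE (pairE (pairE (rawE plegE) unE) (rawE unitE)) natE) (rawE candE)
    (fun p => cands p.1.1.1 p.1.1.2 p.2 p.1.2) := by
  have hsize : CodeFP (pairE natE candE) bitE (fun t => decide (t.2.1.length + t.2.2.length ≤ t.1)) :=
    (natLe.comp ((natAdd.comp (((natLength labE).comp (snd _ _).fst').pair
      ((natLength labE).comp (snd _ _).snd'))).pair (fst _ _))).congr fun _ => rfl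
  have hws : CodeFP (pairE (pairE (pairE (rawE plegE) unE) (rawE unitE)) natE) (rawE candE)
      (fun p => (walksC p.1.1.1 p.1.1.2 p.1.2).map fun w => sidesOf w.2) :=
    ((map₀ (codeFP_sidesOf.comp (snd labE (rawE labE)))).comp (codeFP_walksC.comp (fst _ _))).congr fun _ => rfl
  exact ((filter hsize).comp ((snd _ _).pair hws)).congr fun _ => rfl

/-- The remainder-leg test `inPair` is polynomial time. -/
theorem codeFP_inPair : CodeFP (pairE candE (pairE natE plegE)) bitE (fun t => inPair t.1 t.2) :=
  ((natEq.comp ((snd _ _).fst'.pair (const _ (0 : ℕ)))).and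
    (((mem labE_injective).comp ((codeFP_labL.comp (snd _ _).snd').pair (fst _ _).fst')).and
      ((mem labE_injective).comp ((codeFP_labR.comp (snd _ _).snd').pair (fst _ _).snd')))).congr fun _ => rfl

/-- `eCount` is polynomial time (input `(pieced legs, labels, pair)`). -/
theorem codeFP_eCount : CodeFP (pairE (rawE plegE) (pairE (rawE natE) candE)) natE
    (fun t => eCount t.1 t.2.1 t.2.2) := by
  have hz : CodeFP (pairE (rawE plegE) (pairE (rawE natE) candE)) (rawE (pairE natE plegE))
      (fun t => t.2.1.zip t.1) :=
    ((rawZip natE plegE).comp ((snd _ _).fst'.pair (fst _ _))).congr fun _ => rfl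
  exact ((natLength (pairE natE plegE)).comp ((filter codeFP_inPair).comp
    ((snd _ _).snd'.pair hz))).congr fun _ => rfl

/-- The density test is polynomial time (input `(γsq, pieced legs, labels, pair)`). -/
theorem codeFP_dense : CodeFP (pairE natE (pairE (rawE plegE) (pairE (rawE natE) candE))) bitE
    (fun t => dense t.1 t.2.1 t.2.2.1 t.2.2.2) := by
  have he : CodeFP (pairE natE (pairE (rawE plegE) (pairE (rawE natE) candE))) natE
      (fun t => eCount t.2.1 t.2.2.1 t.2.2.2) := codeFP_eCount.comp (snd _ _)
  have hW : CodeFP (pairE natE (pairE (rawE plegE) (pairE (rawE natE) candE))) candE (fun t => t.2.2.2) :=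
    (snd _ _).snd'.snd'
  exact (natLt.comp ((natMul.comp ((natMul.comp ((fst _ _).pair ((natLength labE).comp hW.fst'))).pair
    ((natLength labE).comp hW.snd'))).pair (natMul.comp (he.pair he)))).congr fun _ => rfl

/-- `relabel` is polynomial time (input `(pieced legs, labels, r, pair)`). -/
theorem codeFP_relabel : CodeFP (pairE (rawE plegE) (pairE (rawE natE) (pairE natE candE))) (rawE natE)
    (fun t => relabel t.1 t.2.1 t.2.2.1 t.2.2.2) := by
  have hg : CodeFP (pairE (pairE natE candE) (pairE natE plegE)) natE
      (fun t => if inPair t.1.2 (t.2.1, t.2.2) then t.1.1 + 1 else t.2.1) :=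
    ((codeFP_inPair.comp ((fst _ _).snd'.pair (snd _ _))).ite
      (natAdd.comp ((fst _ _).fst'.pair (const _ (1 : ℕ)))) (snd _ _).fst').congr fun _ => rfl
  exact ((zipWith hg).comp ((snd _ _).snd'.pair ((snd _ _).fst'.pair (fst _ _)))).congr fun _ => rfl

/-- One extraction round is polynomial time (context `((pieced legs, candidates), γsq)`). -/
theorem codeFP_extractStep : CodeFP (pairE (pairE (pairE (rawE plegE) (rawE candE)) natE) xstE) xstE
    (fun t => extractStep t.1.2 t.1.1.1 t.1.1.2 t.2) := by
  -- the search
  have hp : CodeFP (pairE (pairE (pairE (pairE (rawE plegE) (rawE candE)) natE) xstE) candE) bitE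
      (fun q => dense q.1.1.2 q.1.1.1.1 q.1.2.1 q.2) :=
    (codeFP_dense.comp ((fst _ _).fst'.snd'.pair ((fst _ _).fst'.fst'.fst'.pair
      ((fst _ _).snd'.fst'.pair (snd _ _))))).congr fun _ => rfl
  have hfind : CodeFP (pairE (pairE (pairE (rawE plegE) (rawE candE)) natE) xstE) (optE candE)
      (fun t => t.1.1.2.find? fun W => dense t.1.2 t.1.1.1 t.2.1 W) :=
    ((rawFind? hp).comp ((CodeFP.id _).pair (fst _ _).fst'.snd')).congr fun _ => rfl
  -- the two branches
  have hsome : CodeFP (pairE (pairE (pairE (pairE (rawE plegE) (rawE candE)) natE) xstE) candE) xstE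
      (fun q => (relabel q.1.1.1.1 q.1.2.1 q.1.2.2 q.2, q.1.2.2 + 1)) :=
    (codeFP_relabel.comp ((fst _ _).fst'.fst'.fst'.pair ((fst _ _).snd'.fst'.pair
      ((fst _ _).snd'.snd'.pair (snd _ _))))).pair (natAdd.comp ((fst _ _).snd'.snd'.pair (const _ (1 : ℕ))))
  have h := optCases (k := fun (t : ((List PLeg × List Cand) × ℕ) × (List ℕ × ℕ)) (o : Option Cand) =>
      match o with
      | none => t.2
      | some W => (relabel t.1.1.1 t.2.1 t.2.2 W, t.2.2 + 1))
    (snd _ _) hsome (fun _ => rfl) (fun _ _ => rfl)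
  exact (h.comp ((CodeFP.id _).pair hfind)).congr fun t => by
    unfold extractStep
    cases t.1.1.2.find? (fun W => dense t.1.2 t.1.1.1 t.2.1 W) <;> rfl

/-- The initial state is polynomial time. -/
theorem codeFP_extractInit : CodeFP (rawE plegE) xstE extractInit :=
  ((map₀ (const plegE (eβ := natE) (0 : ℕ))).pair (const (rawE plegE) (eβ := natE) (0 : ℕ))).congr fun _ => rfl

/-- **The extraction is polynomial time** (context `((pieced legs, candidates), γsq)`, budget = rounds as units). -/
theorem codeFP_extract : CodeFP (pairE (pairE (pairE (rawE plegE) (rawE candE)) natE) (rawE unitE)) xstE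
    (fun p => extract p.1.2 p.1.1.1 p.1.1.2 p.2) := by
  have hstep : CodeFP (pairE (pairE (pairE (rawE plegE) (rawE candE)) natE) (pairE unitE xstE)) xstE
      (fun t => extractStep t.1.2 t.1.1.1 t.1.1.2 t.2.2) :=
    (codeFP_extractStep.comp ((fst _ _).pair (snd _ _).snd')).congr fun _ => rfl
  have hinit : CodeFP (pairE (pairE (rawE plegE) (rawE candE)) natE) xstE (fun s => extractInit s.1.1) :=
    codeFP_extractInit.comp (fst _ _).fst'
  have h := foldl (σ := (List PLeg × List Cand) × ℕ) (α := Unit) (β := List ℕ × ℕ)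
    (eσ := pairE (pairE (rawE plegE) (rawE candE)) natE) (eα := unitE) (eβ := xstE)
    (step := fun s _ st => extractStep s.2 s.1.1 s.1.2 st) (init := fun s => extractInit s.1.1) hstep hinit
    (2 * X * (2 * X + 2) + X + 2) (fun s l₁ l₂ => by
      obtain ⟨⟨plegs, cs⟩, γsq⟩ := s
      set n := (pairE (pairE (pairE (rawE plegE) (rawE candE)) natE) (rawE unitE) (((plegs, cs), γsq), l₁ ++ l₂)).length
        with hn
      have hP : plegs.length ≤ n := by
        have := length_le_length_rawE plegE plegs
        rw [hn]; simp only [pairE_apply, length_boolPair]; omega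
      have hl₁ : l₁.length ≤ n := by
        have := length_le_length_rawE unitE (l₁ ++ l₂)
        rw [List.length_append] at this
        rw [hn]; simp only [pairE_apply, length_boolPair]; omega
      have hinv := extractInv_foldl γsq plegs cs l₁ 0 (extractInit plegs) (extractInv_init plegs)
      rw [Nat.zero_add] at hinv
      obtain ⟨hlen, hlab, hr⟩ := hinv
      set st := l₁.foldl (fun st _ => extractStep γsq plegs cs st) (extractInit plegs) with hst
      have hr' : st.2 ≤ n := hr.trans hl₁
      have hitem : ∀ lab ∈ st.1, (natE lab).length ≤ n := fun lab h =>
        (length_natE_le lab).trans ((hlab lab h).trans hr')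
      have h1 := length_rawE_le_of_forall hitem
      have h2 := length_natE_le st.2
      have heval : (2 * X * (2 * X + 2) + X + 2 : Polynomial ℕ).eval n = 2 * n * (2 * n + 2) + n + 2 := by simp
      show (xstE st).length ≤ _
      rw [heval]
      simp only [xstE, pairE_apply, length_boolPair]
      rw [hlen] at h1
      have h3 : plegs.length * (2 * n + 2) ≤ n * (2 * n + 2) := Nat.mul_le_mul_right _ hP
      have h4 : (natE st.2).length ≤ n := h2.trans hr'
      have h5 : 2 * n * (2 * n + 2) = 2 * (n * (2 * n + 2)) := by ring
      rw [h5]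
      omega)
  exact h.congr fun p => rfl

end PolyTime

end Summit.PneNP.PneNP.Theorems.SfmBlMachine
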